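import Summits.QuantumFields.BalabanUV.T4Continuum.Spine.BackgroundResolventLaw

/-!
# T⁴ programme, spine node NE2 (U1a), sub-row Δ1 «NE2⁰-Dirichlet» (T4-DAG `T4-U1a.S-NE2-D1-DIRICHLET°`) — COMPRESSION OF LATTICE
# OPERATORS TO A SUB-LATTICE: selection matrices, `Matrix.toBlock` in operator norm, block-multiplicativity under vanishing
# couplings, and COERCIVE COMPRESSIONS (invertibility and the inverse bound `γ⁻¹`)

Eleventh generation of the NE2 prover lineage P1 of the cell `pub-balaban` (row NE2 owner), file 3: the generic linear algebra
behind the Ω-RESTRICTED («Dirichlet») operators of [Balaban1985BackgroundPropagators] §3 — «the operator Δ_a↾Ω₀ = Ω₀Δ_aΩ₀ … Its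
inverse is denoted by G» (p. 394, (3.27)) — for finite matrices: the restriction of an operator `X` on `ℓ²(m)` to the sites of a
decidable subset `p` is `Matrix.toBlock X p p`, an operator on `ℓ²({a // p a})`.  Used by `Support/DirichletFreeTower` (file 4) to
compress the lineage's free tower (`calDalev`, `Qlev`, `JpcT`) to a union of unit blocks.

 * §1 the SELECTION matrix `sel p : ℓ²(m) → ℓ²({a // p a})` (`sel·selᴴ = 1`, `‖sel‖ ≤ 1`), `X.toBlock p q = sel p · X · (sel q)ᴴ`,
   hence **`opNorm_toBlock_le`** `‖X.toBlock p q‖ ≤ ‖X‖`; algebra of `toBlock` (`conjTranspose`, `smul`, `one`, `sub`).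
 * §2 BLOCK-MULTIPLICATIVITY: `(X·Y).toBlock p r = X.toBlock p q · Y.toBlock q r` as soon as `X` does not couple `p` to `¬q`
   (`toBlock_mul_of_vanish_left`) or `Y` does not couple `¬q` to `r` (`toBlock_mul_of_vanish_right`).
 * §3 EXTENSION BY ZERO `ext p w` and the quadratic form of a compression: `⟨w, X_{pp} w⟩ = ⟨ext w, X ext w⟩`, `‖ext w‖ = ‖w‖`.
 * §4 COERCIVE OPERATORS: `γ‖v‖² ≤ Re⟨v, Xv⟩` (`γ > 0`) ⟹ `X` invertible and `‖X⁻¹‖ ≤ γ⁻¹` (**`isUnit_det_of_coercive`**,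
   **`opNorm_inv_le_of_coercive`**), and coercivity PASSES TO EVERY COMPRESSION (**`coercive_toBlock`**) — the finite-dimensional
   content of «Δ_a↾Ω₀ is positive, hence invertible, with ‖G(Ω₀)‖ ≤ γ₀⁻¹» from (1.90) `γ₀(Δ + I) ≤ Δ_a`.

HONEST FRAMING (T4-DAG p. 1).  [folklore] finite-dimensional linear algebra, statements OURS; nothing printed is a hypothesis; no
carrier of Bałaban's regions `{Ω_j}` is constructed here (file 4 takes ONE region as a decidable predicate on the unit lattice); NOT
infinite volume, NOT a mass gap, NOT the Clay problem, NOT summit progress; NE2 (U1a) NOT proved; spine 0/9 unchanged.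
HONEST DEPENDENCY: continuum YM on T⁴ ⇐ BetaPertH ∧ nine spine estimates (0/9 proved); BetaPertH ⇐ (D1) ∧ (D4) ∧ CAP+tail; G-an2-4
gates asym, D1 and NE2/3/4.  No `sorry`.
-/

noncomputable section

open scoped BigOperators ComplexConjugate Matrix Matrix.Norms.L2Operator

namespace Summit.QuantumFields.BalabanUV.T4Continuum.SubtypeCompression

open Literature.MathematicalPhysics.QuantumFieldTheory.Balaban1983to89.B5Prop11Lower (nsq nsq_nonneg star_dotProduct_self
  norm_star_dotProduct_le)
open Literature.MathematicalPhysics.QuantumFieldTheory.Balaban1983to89.B5Prop11Plancherel (opNorm_le_of_sq_le)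
open Summit.QuantumFields.BalabanUV.T4Continuum.BackgroundResolventLaw (l2_opNorm_one_le)

variable {m n k : Type*} [Fintype m] [DecidableEq m] [Fintype n] [DecidableEq n] [Fintype k] [DecidableEq k]

/-! ## §1 Selection matrices and `toBlock` in operator norm -/

/-- the SELECTION (restriction) matrix onto the sites of a decidable subset: `(sel p · v)(a) = v(a)`. [folklore] -/
def sel (p : m → Prop) [DecidablePred p] : Matrix {a // p a} m ℂ := fun a j => if (a : m) = j then 1 else 0

section Sel

variable (p : m → Prop) [DecidablePred p] (q : n → Prop) [DecidablePred q] (r : k → Prop) [DecidablePred r]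

omit [Fintype n] [DecidableEq n] in
/-- rows of `sel p · X` are the selected rows of `X`. [folklore] -/
theorem sel_mul_apply (X : Matrix m n ℂ) (a : {a // p a}) (b : n) : (sel p * X) a b = X a b := by
  simp only [Matrix.mul_apply, sel, ite_mul, one_mul, zero_mul, Finset.sum_ite_eq, Finset.mem_univ, if_true]

omit [Fintype n] [DecidableEq n] in
/-- columns of `X · (sel p)ᴴ` are the selected columns of `X`. [folklore] -/
theorem mul_sel_conjTranspose_apply (X : Matrix n m ℂ) (b : n) (a : {a // p a}) : (X * (sel p)ᴴ) b a = X b a := by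
  simp only [Matrix.mul_apply, sel, Matrix.conjTranspose_apply, apply_ite star, star_one, star_zero, mul_ite, mul_one,
    mul_zero]
  rw [Finset.sum_ite_eq]
  simp

/-- **`X.toBlock p q = sel p · X · (sel q)ᴴ`**. [folklore] -/
theorem toBlock_eq_sel (X : Matrix m n ℂ) : X.toBlock p q = sel p * X * (sel q)ᴴ := by
  ext a b
  rw [mul_sel_conjTranspose_apply, sel_mul_apply]; rfl

/-- `sel p · (sel p)ᴴ = 1` (restriction of the extension is the identity). [folklore] -/
theorem sel_mul_sel_conjTranspose : sel p * (sel p)ᴴ = 1 := by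
  ext a b
  rw [mul_sel_conjTranspose_apply]
  simp only [sel, Matrix.one_apply, Subtype.ext_iff]

/-- `‖sel p‖ ≤ 1`. [folklore] -/
theorem opNorm_sel_le : ‖sel p‖ ≤ 1 := by
  have h : ‖sel p‖ * ‖sel p‖ = ‖sel p * (sel p)ᴴ‖ := by
    have h1 := Matrix.l2_opNorm_conjTranspose_mul_self (sel p)ᴴ
    rw [Matrix.conjTranspose_conjTranspose, Matrix.l2_opNorm_conjTranspose] at h1
    exact h1.symm
  rw [sel_mul_sel_conjTranspose] at h
  have h2 : ‖sel p‖ * ‖sel p‖ ≤ 1 := h ▸ l2_opNorm_one_le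
  nlinarith [norm_nonneg (sel p)]

/-- **the operator norm of a block is at most the operator norm**: `‖X.toBlock p q‖ ≤ ‖X‖`. [folklore] -/
theorem opNorm_toBlock_le (X : Matrix m n ℂ) : ‖X.toBlock p q‖ ≤ ‖X‖ := by
  rw [toBlock_eq_sel]
  calc ‖sel p * X * (sel q)ᴴ‖ ≤ ‖sel p * X‖ * ‖(sel q)ᴴ‖ := Matrix.l2_opNorm_mul _ _
    _ ≤ ‖sel p‖ * ‖X‖ * ‖(sel q)ᴴ‖ := mul_le_mul_of_nonneg_right (Matrix.l2_opNorm_mul _ _) (norm_nonneg _)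
    _ ≤ 1 * ‖X‖ * 1 := by
        rw [Matrix.l2_opNorm_conjTranspose]
        exact mul_le_mul (mul_le_mul_of_nonneg_right (opNorm_sel_le p) (norm_nonneg _)) (opNorm_sel_le q)
          (norm_nonneg _) (mul_nonneg zero_le_one (norm_nonneg _))
    _ = ‖X‖ := by ring

omit [Fintype m] [DecidableEq m] [Fintype n] [DecidableEq n] [DecidablePred p] [DecidablePred q] in
/-- `(X.toBlock p q)ᴴ = Xᴴ.toBlock q p`. [folklore] -/
theorem toBlock_conjTranspose (X : Matrix m n ℂ) : (X.toBlock p q)ᴴ = Xᴴ.toBlock q p := rfl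

omit [Fintype m] [DecidableEq m] [Fintype n] [DecidableEq n] [DecidablePred p] [DecidablePred q] in
/-- `(c • X).toBlock p q = c • X.toBlock p q`. [folklore] -/
theorem toBlock_smul (c : ℂ) (X : Matrix m n ℂ) : (c • X).toBlock p q = c • X.toBlock p q := rfl

omit [Fintype m] [DecidableEq m] [Fintype n] [DecidableEq n] [DecidablePred p] [DecidablePred q] in
/-- `(X − Y).toBlock p q = X.toBlock p q − Y.toBlock p q`. [folklore] -/
theorem toBlock_sub (X Y : Matrix m n ℂ) : (X - Y).toBlock p q = X.toBlock p q - Y.toBlock p q := rfl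

omit [Fintype m] [DecidableEq m] [Fintype n] [DecidableEq n] [DecidablePred p] [DecidablePred q] in
/-- `(X + Y).toBlock p q = X.toBlock p q + Y.toBlock p q`. [folklore] -/
theorem toBlock_add (X Y : Matrix m n ℂ) : (X + Y).toBlock p q = X.toBlock p q + Y.toBlock p q := rfl

omit [Fintype m] [DecidablePred p] in
/-- `(1).toBlock p p = 1`. [folklore] -/
theorem toBlock_one : (1 : Matrix m m ℂ).toBlock p p = 1 := by
  ext a b
  simp only [Matrix.toBlock_apply, Matrix.one_apply, Subtype.ext_iff]

/-! ## §2 Block-multiplicativity under vanishing couplings -/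

omit [Fintype m] [DecidableEq m] [DecidableEq n] [Fintype k] [DecidableEq k] [DecidablePred p] [DecidablePred r] in
/-- if `X` does not couple `p`-rows to `¬q`-columns, `(X·Y)_{pr} = X_{pq}·Y_{qr}`. [folklore] -/
theorem toBlock_mul_of_vanish_left (X : Matrix m n ℂ) (Y : Matrix n k ℂ) (hX : ∀ i j, p i → ¬ q j → X i j = 0) :
    (X * Y).toBlock p r = X.toBlock p q * Y.toBlock q r := by
  rw [Matrix.toBlock_mul_eq_add p q r X Y]
  have h0 : X.toBlock p (fun j => ¬ q j) = 0 := by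
    ext a b; exact hX a b a.2 b.2
  rw [h0, Matrix.zero_mul, add_zero]

omit [Fintype m] [DecidableEq m] [DecidableEq n] [Fintype k] [DecidableEq k] [DecidablePred p] [DecidablePred r] in
/-- if `Y` does not couple `¬q`-rows to `r`-columns, `(X·Y)_{pr} = X_{pq}·Y_{qr}`. [folklore] -/
theorem toBlock_mul_of_vanish_right (X : Matrix m n ℂ) (Y : Matrix n k ℂ) (hY : ∀ j l, ¬ q j → r l → Y j l = 0) :
    (X * Y).toBlock p r = X.toBlock p q * Y.toBlock q r := by
  rw [Matrix.toBlock_mul_eq_add p q r X Y]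
  have h0 : Y.toBlock (fun j => ¬ q j) r = 0 := by
    ext a b; exact hY a b a.2 b.2
  rw [h0, Matrix.mul_zero, add_zero]

end Sel

/-! ## §3 Extension by zero and the quadratic form of a compression -/

section Ext

variable (p : m → Prop) [DecidablePred p]

/-- EXTENSION BY ZERO of a field on the selected sites to the whole lattice. [folklore] -/
def ext (w : {a // p a} → ℂ) : m → ℂ := fun i => if h : p i then w ⟨i, h⟩ else 0

omit [Fintype m] [DecidableEq m] in
/-- on selected sites the extension is the field. [folklore] -/
theorem ext_apply_of (w : {a // p a} → ℂ) (a : {a // p a}) : ext p w a = w a := by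
  simp only [ext, a.2, dif_pos]

omit [Fintype m] [DecidableEq m] in
/-- off the selected sites the extension vanishes. [folklore] -/
theorem ext_apply_of_not (w : {a // p a} → ℂ) {i : m} (hi : ¬ p i) : ext p w i = 0 := by
  simp only [ext, hi, dif_neg, not_false_eq_true]

omit [DecidableEq m] in
/-- `‖ext w‖² = ‖w‖²`. [folklore] -/
theorem nsq_ext (w : {a // p a} → ℂ) : nsq (ext p w) = nsq w := by
  unfold nsq
  rw [← Fintype.sum_subtype_add_sum_subtype p (fun i => ‖ext p w i‖ ^ 2)]
  have h2 : ∑ i : {i // ¬ p i}, ‖ext p w i‖ ^ 2 = 0 :=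
    Finset.sum_eq_zero fun i _ => by rw [ext_apply_of_not p w i.2, norm_zero, zero_pow two_ne_zero]
  rw [h2, add_zero]
  exact Finset.sum_congr rfl fun a _ => by rw [ext_apply_of]

omit [DecidableEq m] in
/-- `⟨ext w, u⟩ = ⟨w, u|_p⟩`. [folklore] -/
theorem star_ext_dotProduct (w : {a // p a} → ℂ) (u : m → ℂ) :
    star (ext p w) ⬝ᵥ u = star w ⬝ᵥ (fun a : {a // p a} => u a) := by
  unfold dotProduct
  rw [← Fintype.sum_subtype_add_sum_subtype p (fun i => star (ext p w) i * u i)]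
  have h2 : ∑ i : {i // ¬ p i}, star (ext p w) i * u i = 0 :=
    Finset.sum_eq_zero fun i _ => by rw [Pi.star_apply, ext_apply_of_not p w i.2, star_zero, zero_mul]
  rw [h2, add_zero]
  exact Finset.sum_congr rfl fun a _ => by rw [Pi.star_apply, Pi.star_apply, ext_apply_of]

omit [DecidableEq m] in
/-- the compression acts as «extend by zero, apply, restrict»: `X_{pp}·w = (X·ext w)|_p`. [folklore] -/
theorem toBlock_mulVec (X : Matrix m m ℂ) (w : {a // p a} → ℂ) :
    X.toBlock p p *ᵥ w = fun a : {a // p a} => (X *ᵥ ext p w) a := by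
  funext a
  simp only [Matrix.mulVec, dotProduct, Matrix.toBlock_apply]
  rw [← Fintype.sum_subtype_add_sum_subtype p (fun i => X a i * ext p w i)]
  have h2 : ∑ i : {i // ¬ p i}, X a i * ext p w i = 0 :=
    Finset.sum_eq_zero fun i _ => by rw [ext_apply_of_not p w i.2, mul_zero]
  rw [h2, add_zero]
  exact Finset.sum_congr rfl fun b _ => by rw [ext_apply_of]

omit [DecidableEq m] in
/-- **the quadratic form of a compression**: `⟨w, X_{pp} w⟩ = ⟨ext w, X·ext w⟩`. [folklore] -/
theorem form_toBlock (X : Matrix m m ℂ) (w : {a // p a} → ℂ) :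
    star w ⬝ᵥ (X.toBlock p p *ᵥ w) = star (ext p w) ⬝ᵥ (X *ᵥ ext p w) := by
  rw [toBlock_mulVec, star_ext_dotProduct]

end Ext

/-! ## §4 Coercive operators: invertibility, the inverse bound, and compressions -/

section Coercive

/-- COERCIVITY of a square matrix with constant `γ`: `γ·‖v‖² ≤ Re⟨v, Xv⟩` for every vector. [folklore] -/
def Coercive (X : Matrix m m ℂ) (γ : ℝ) : Prop := ∀ v : m → ℂ, γ * nsq v ≤ (star v ⬝ᵥ (X *ᵥ v)).re

omit [DecidableEq m] in
/-- a vector of zero `ℓ²` mass is zero. [folklore] -/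
theorem eq_zero_of_nsq_eq_zero {v : m → ℂ} (h : nsq v = 0) : v = 0 := by
  funext i
  have hi := (Finset.sum_eq_zero_iff_of_nonneg (fun j _ => by positivity)).mp h i (Finset.mem_univ i)
  exact norm_eq_zero.mp (pow_eq_zero_iff two_ne_zero |>.mp hi)

/-- **a coercive matrix is invertible** (`γ > 0`). [folklore] -/
theorem isUnit_det_of_coercive {X : Matrix m m ℂ} {γ : ℝ} (hγ : 0 < γ) (h : Coercive X γ) : IsUnit X.det := by
  rw [Matrix.isUnit_iff_isUnit_det X |>.symm, ← Matrix.mulVec_injective_iff_isUnit]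
  intro v w hvw
  have h0 : X *ᵥ (v - w) = 0 := by rw [Matrix.mulVec_sub, hvw, sub_self]
  have hc := h (v - w)
  rw [h0, dotProduct_zero, Complex.zero_re] at hc
  have hn : nsq (v - w) = 0 := le_antisymm (nonpos_of_mul_nonpos_right (by linarith) hγ |> fun h => h) (nsq_nonneg _)
  exact sub_eq_zero.mp (eq_zero_of_nsq_eq_zero hn)

omit [DecidableEq m] in
/-- under coercivity `γ‖v‖ ≤ ‖Xv‖` in the squared form `γ²·nsq v ≤ nsq (Xv)`. [folklore] -/
theorem sq_nsq_le_of_coercive {X : Matrix m m ℂ} {γ : ℝ} (hγ : 0 < γ) (h : Coercive X γ) (v : m → ℂ) :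
    γ ^ 2 * nsq v ≤ nsq (X *ᵥ v) := by
  have h1 : γ * nsq v ≤ Real.sqrt (nsq v) * Real.sqrt (nsq (X *ᵥ v)) :=
    (h v).trans ((Complex.re_le_norm _).trans (norm_star_dotProduct_le v (X *ᵥ v)))
  have hs : Real.sqrt (nsq v) ^ 2 = nsq v := Real.sq_sqrt (nsq_nonneg v)
  have ht : Real.sqrt (nsq (X *ᵥ v)) ^ 2 = nsq (X *ᵥ v) := Real.sq_sqrt (nsq_nonneg _)
  -- `γ s² ≤ s t` with `s, t ≥ 0` gives `γ² s² ≤ t²`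
  have hs0 : 0 ≤ Real.sqrt (nsq v) := Real.sqrt_nonneg _
  have ht0 : 0 ≤ Real.sqrt (nsq (X *ᵥ v)) := Real.sqrt_nonneg _
  rcases hs0.eq_or_lt with hz | hpos
  · rw [← hs, ← hz]; simp [nsq_nonneg]
  · have h2 : γ * Real.sqrt (nsq v) ≤ Real.sqrt (nsq (X *ᵥ v)) := by
      have h1' : (γ * Real.sqrt (nsq v)) * Real.sqrt (nsq v) ≤ Real.sqrt (nsq (X *ᵥ v)) * Real.sqrt (nsq v) := by
        rw [mul_assoc, ← pow_two, hs, mul_comm (Real.sqrt (nsq (X *ᵥ v)))]; exact h1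
      exact le_of_mul_le_mul_right h1' hpos
    have h3 := mul_le_mul h2 h2 (mul_nonneg hγ.le hs0) ht0
    rw [← hs, ← ht]; nlinarith [h3]

/-- **THE INVERSE BOUND**: a coercive matrix with constant `γ > 0` has `‖X⁻¹‖ ≤ γ⁻¹`. [folklore] -/
theorem opNorm_inv_le_of_coercive {X : Matrix m m ℂ} {γ : ℝ} (hγ : 0 < γ) (h : Coercive X γ) : ‖X⁻¹‖ ≤ γ⁻¹ := by
  have hU := isUnit_det_of_coercive hγ h
  refine opNorm_le_of_sq_le X⁻¹ (inv_nonneg.mpr hγ.le) fun y => ?_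
  have key := sq_nsq_le_of_coercive hγ h (X⁻¹ *ᵥ y)
  rw [Matrix.mulVec_mulVec, Matrix.mul_nonsing_inv X hU, Matrix.one_mulVec] at key
  have e1 : ∑ i, ‖∑ j, X⁻¹ i j * y j‖ ^ 2 = nsq (X⁻¹ *ᵥ y) := rfl
  have e2 : ∑ j, ‖y j‖ ^ 2 = nsq y := rfl
  rw [e1, e2, inv_pow]
  rw [le_inv_mul_iff₀ (pow_pos hγ 2)]
  exact key

variable (p : m → Prop) [DecidablePred p]

omit [DecidableEq m] in
/-- **COERCIVITY PASSES TO COMPRESSIONS**: `Coercive X γ ⟹ Coercive (X.toBlock p p) γ`. [folklore] -/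
theorem coercive_toBlock {X : Matrix m m ℂ} {γ : ℝ} (h : Coercive X γ) : Coercive (X.toBlock p p) γ := by
  intro w
  rw [form_toBlock, ← nsq_ext p w]
  exact h (ext p w)

/-- hence a compression of a coercive matrix is invertible … [folklore] -/
theorem isUnit_det_toBlock_of_coercive {X : Matrix m m ℂ} {γ : ℝ} (hγ : 0 < γ) (h : Coercive X γ) :
    IsUnit (X.toBlock p p).det :=
  isUnit_det_of_coercive hγ (coercive_toBlock p h)

/-- … with inverse bounded by `γ⁻¹` — «‖G(Ω₀)‖ ≤ γ₀⁻¹» for the Ω-restricted operator. [folklore] -/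
theorem opNorm_inv_toBlock_le_of_coercive {X : Matrix m m ℂ} {γ : ℝ} (hγ : 0 < γ) (h : Coercive X γ) :
    ‖(X.toBlock p p)⁻¹‖ ≤ γ⁻¹ :=
  opNorm_inv_le_of_coercive hγ (coercive_toBlock p h)

omit [DecidableEq m] in
/-- coercivity from a real lower bound on the Hermitian form: if `Re⟨v, Yv⟩ ≥ 0` for all `v` and `X = γ·1 + Y`-like bounds hold
in the form `γ·nsq v ≤ Re⟨v,Xv⟩`, this is `Coercive` by definition; recorded as the constructor used by file 4. [folklore] -/
theorem coercive_of_forall {X : Matrix m m ℂ} {γ : ℝ} (h : ∀ v : m → ℂ, γ * nsq v ≤ (star v ⬝ᵥ (X *ᵥ v)).re) :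
    Coercive X γ := h

end Coercive

end Summit.QuantumFields.BalabanUV.T4Continuum.SubtypeCompression

end
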